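import Summits.Ventures.LatticeQCDFlow.Scoring.U1TorusPlaquetteBounds
import Summits.Ventures.LatticeQCDFlow.Scoring.OnePlaquetteEnclosures
import Summits.Ventures.LatticeQCDFlow.Scoring.OnePlaquetteBessel
import HarnessLib

/-!
# A rational certificate for the exact plaquette of the 2-d `U(1)` torus

HONEST FRAMING: exact (Metropolis-corrected) sampling algorithms for lattice gauge theory;
figures of merit are autocorrelation/cost numbers at stated couplings and volumes; no
continuum-physics claim.

Venture `LatticeQCDFlow` (cell pub-lqcd), sub-topic `Scoring`; FANOUT row 5 (`s0-sun-a`), GEN-8.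
NEW WORK of the cell (placement rule), part 2 of 3 of the kernel-checked enclosures of the exact
`16²` TORUS plaquette `⟨cos θ_p⟩_{L₁×L₂,β} = N/Z` of 2-d `U(1)` (`Scoring/U1TorusCharacterFormula.lean`,
GEN-7) — the values the frozen scorers' `reference_table v0.3` holds, which at `β = 6, 7` lie
OUTSIDE GEN-5's infinite-volume enclosures (`Scoring/OnePlaquetteEnclosures.lean`).

* §1 **`torus_ratio_mem_Icc`** — assembling `Scoring/U1TorusPlaquetteBounds.lean`: for `β > 0`,
  `V ≥ 3`, `a ≤ I₁/I₀ ≤ b`, `e^β ≤ E`, interval arithmetic through `I₂ = I₀ − 2I₁/β`,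
  `I₃ = I₁ − 4I₂/β`, `I₄ = I₂ − 6I₃/β`, the five central charges and the tail bounds gives
  `lo ≤ N/Z ≤ hi` from two rational inequalities;
* §2 the checker **`torusPlaqCheck β a b E lo hi K V`** = GEN-5's `u1Check β a b K`
  (`a ≤ ⟨cos θ⟩_β = I₁/I₀ ≤ b`, `Scoring/OnePlaquetteBessel.lean`) `∧` `torusRatioCheck`, and its
  soundness **`torusPlaqCheck_sound`**.

The instances (`β = 1,…,7`, `L = 16`) are `Scoring/U1TorusPlaquetteEnclosures.lean`.  Elementary;
nothing is cited.
-/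

noncomputable section

open Real Finset
open scoped Nat
open Literature.Analysis.FunctionSpaces

namespace Summit.Ventures.LatticeQCDFlow.Scoring

/-! ### 1. From `a ≤ I₁/I₀ ≤ b` to an enclosure of the torus plaquette -/

/-- **Interval arithmetic for the torus plaquette.**  `β > 0`, `V = W + 3 ≥ 3`; if
`a ≤ I₁(β)/I₀(β) ≤ b`, `e^β ≤ E`, and with `c = 1 − 2b/β`, `d = 1 − 2a/β`, `e = a − 4d/β`,
`f = b − 4c/β`, `g = d − 6e/β`, `M = max f g` the inequalities `0 < a`, `0 ≤ c`, `0 ≤ e`, `0 ≤ lo`,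
`lo·(1 + 2b^V + 2d^V + M^{V−1}E) ≤ a + a^{V−1}(1+c) + c^{V−1}(a+e)` and
`b + b^{V−1}(1+d) + d^{V−1}(b+f) + M^{V−2}E ≤ hi·(1 + 2a^V + 2c^V)` hold, then `lo ≤ N/Z ≤ hi`. -/
theorem torus_ratio_mem_Icc {β : ℝ} (hβ : 0 < β) (W : ℕ) {a b c d e f g M E lo hi : ℝ}
    (hab : a ≤ besselI 1 β / besselI 0 β) (hba : besselI 1 β / besselI 0 β ≤ b)
    (hE : Real.exp β ≤ E) (hc : c = 1 - 2 * b / β) (hd : d = 1 - 2 * a / β)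
    (he : e = a - 4 * d / β) (hf : f = b - 4 * c / β) (hg : g = d - 6 * e / β) (hM : M = max f g)
    (h0a : 0 < a) (h0c : 0 ≤ c) (h0e : 0 ≤ e) (h0lo : 0 ≤ lo)
    (hlo : lo * (1 + 2 * b ^ (W + 3) + 2 * d ^ (W + 3) + M ^ (W + 2) * E) ≤
      a + a ^ (W + 2) * (1 + c) + c ^ (W + 2) * (a + e))
    (hhi : b + b ^ (W + 2) * (1 + d) + d ^ (W + 2) * (b + f) + M ^ (W + 1) * E ≤
      hi * (1 + 2 * a ^ (W + 3) + 2 * c ^ (W + 3))) :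
    lo ≤ (∑' k : ℤ, besselI k.natAbs β ^ (W + 3 - 1) *
            ((besselI (k - 1).natAbs β + besselI (k + 1).natAbs β) / 2)) /
          ∑' k : ℤ, besselI k.natAbs β ^ (W + 3) ∧
    (∑' k : ℤ, besselI k.natAbs β ^ (W + 3 - 1) *
            ((besselI (k - 1).natAbs β + besselI (k + 1).natAbs β) / 2)) /
          ∑' k : ℤ, besselI k.natAbs β ^ (W + 3) ≤ hi := by
  have hβ0 : β ≠ 0 := hβ.ne'
  -- the Bessel values and their elementary bounds
  set I0 := besselI 0 β with hI0def
  set I1 := besselI 1 β with hI1def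
  have hI0 : 0 < I0 := besselI_pos 0 hβ
  have hI0' : 1 ≤ I0 := one_le_besselI_zero β
  have hI1 : 0 < I1 := besselI_pos 1 hβ
  have hI2p : 0 < besselI 2 β := besselI_pos 2 hβ
  have hI3p : 0 < besselI 3 β := besselI_pos 3 hβ
  have h1lo : a * I0 ≤ I1 := by rwa [le_div_iff₀ hI0] at hab
  have h1hi : I1 ≤ b * I0 := by rwa [div_le_iff₀ hI0] at hba
  have h0b : 0 < b := lt_of_lt_of_le h0a (le_of_mul_le_mul_right (h1lo.trans h1hi) hI0)
  have h2eq : besselI 2 β = I0 - 2 / β * I1 := by rw [besselI_two_eq hβ0]; ring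
  have h3eq : besselI 3 β = I1 - 4 / β * besselI 2 β := by rw [besselI_three_eq hβ0]; ring
  have h4eq : besselI 4 β = besselI 2 β - 6 / β * besselI 3 β := by rw [besselI_four_eq hβ0]; ring
  have h2β : (0 : ℝ) ≤ 2 / β := by positivity
  have h4β : (0 : ℝ) ≤ 4 / β := by positivity
  have h6β : (0 : ℝ) ≤ 6 / β := by positivity
  have h2lo : c * I0 ≤ besselI 2 β := by
    rw [h2eq, hc, show (1 - 2 * b / β) * I0 = I0 - 2 / β * (b * I0) by ring]
    linarith [mul_le_mul_of_nonneg_left h1hi h2β]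
  have h2hi : besselI 2 β ≤ d * I0 := by
    rw [h2eq, hd, show (1 - 2 * a / β) * I0 = I0 - 2 / β * (a * I0) by ring]
    linarith [mul_le_mul_of_nonneg_left h1lo h2β]
  have h3lo : e * I0 ≤ besselI 3 β := by
    rw [h3eq, he, show (a - 4 * d / β) * I0 = a * I0 - 4 / β * (d * I0) by ring]
    linarith [mul_le_mul_of_nonneg_left h2hi h4β]
  have h3hi : besselI 3 β ≤ f * I0 := by
    rw [h3eq, hf, show (b - 4 * c / β) * I0 = b * I0 - 4 / β * (c * I0) by ring]
    linarith [mul_le_mul_of_nonneg_left h2lo h4β]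
  have h4hi : besselI 4 β ≤ g * I0 := by
    rw [h4eq, hg, show (d - 6 * e / β) * I0 = d * I0 - 6 / β * (e * I0) by ring]
    linarith [mul_le_mul_of_nonneg_left h3lo h6β]
  have hcI0 : 0 ≤ c * I0 := by positivity
  have heI0 : 0 ≤ e * I0 := by positivity
  have h0d : 0 ≤ d := le_of_mul_le_mul_right (by linarith [hI2p.le] : 0 * I0 ≤ d * I0) hI0
  have h0f : 0 ≤ f := le_of_mul_le_mul_right (by linarith [hI3p.le] : 0 * I0 ≤ f * I0) hI0
  -- `m = max(I₃, I₄) ≤ M·I₀`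
  set m := max (besselI 3 β) (besselI 4 β) with hm
  have hm0 : 0 ≤ m := hI3p.le.trans (le_max_left _ _)
  have hmM : m ≤ M * I0 := by
    rw [hM, max_mul_of_nonneg _ _ hI0.le]
    exact max_le_max h3hi h4hi
  have hM0 : 0 ≤ M := le_of_mul_le_mul_right (by linarith : 0 * I0 ≤ M * I0) hI0
  -- splitting the sums
  have hVZ : 1 ≤ W + 3 := by omega
  have hVN : 2 ≤ W + 3 := by omega
  have hZsplit := (summable_besselI_natAbs_pow hβ hVZ).sum_add_tsum_subtype_compl centralCharges
  have hNsplit := (summable_torusN_term hβ hVN).sum_add_tsum_subtype_compl centralCharges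
  rw [torusZ_central] at hZsplit
  rw [torusN_central] at hNsplit
  obtain ⟨hZt0, hZt1⟩ := torusZ_tail_bounds hβ hVZ
  obtain ⟨hNt0, hNt1⟩ := torusN_tail_bounds hβ hVN
  rw [← hm] at hZt1 hNt1
  simp only [show W + 3 - 1 = W + 2 from rfl, show W + 3 - 2 = W + 1 from rfl] at *
  rw [← hZsplit, ← hNsplit]
  -- abbreviations for the tails
  set Zt := ∑' k : {k : ℤ // k ∉ centralCharges}, besselI k.1.natAbs β ^ (W + 3) with hZt
  set Nt := ∑' k : {k : ℤ // k ∉ centralCharges}, besselI k.1.natAbs β ^ (W + 2) *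
    ((besselI (k.1 - 1).natAbs β + besselI (k.1 + 1).natAbs β) / 2) with hNt
  -- power bounds
  have hp1lo : (a * I0) ^ (W + 3) ≤ I1 ^ (W + 3) := pow_le_pow_left₀ (by positivity) h1lo _
  have hp1hi : I1 ^ (W + 3) ≤ (b * I0) ^ (W + 3) := pow_le_pow_left₀ hI1.le h1hi _
  have hp2lo : (c * I0) ^ (W + 3) ≤ besselI 2 β ^ (W + 3) := pow_le_pow_left₀ hcI0 h2lo _
  have hp2hi : besselI 2 β ^ (W + 3) ≤ (d * I0) ^ (W + 3) := pow_le_pow_left₀ hI2p.le h2hi _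
  have hq1lo : (a * I0) ^ (W + 2) ≤ I1 ^ (W + 2) := pow_le_pow_left₀ (by positivity) h1lo _
  have hq1hi : I1 ^ (W + 2) ≤ (b * I0) ^ (W + 2) := pow_le_pow_left₀ hI1.le h1hi _
  have hq2lo : (c * I0) ^ (W + 2) ≤ besselI 2 β ^ (W + 2) := pow_le_pow_left₀ hcI0 h2lo _
  have hq2hi : besselI 2 β ^ (W + 2) ≤ (d * I0) ^ (W + 2) := pow_le_pow_left₀ hI2p.le h2hi _
  have hI0pow1 : I0 ^ (W + 2) ≤ I0 ^ (W + 3) := pow_le_pow_right₀ hI0' (by omega)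
  have hI0pow2 : I0 ^ (W + 1) * I0 ≤ I0 ^ (W + 3) := by
    rw [← pow_succ]; exact pow_le_pow_right₀ hI0' (by omega)
  -- tails in units of `I₀^V`
  have hZt2 : Zt ≤ I0 ^ (W + 3) * (M ^ (W + 2) * E) := by
    calc Zt ≤ m ^ (W + 2) * Real.exp β := hZt1
      _ ≤ (M * I0) ^ (W + 2) * E :=
          mul_le_mul (pow_le_pow_left₀ hm0 hmM _) hE (Real.exp_pos β).le (by positivity)
      _ = M ^ (W + 2) * E * I0 ^ (W + 2) := by ring
      _ ≤ M ^ (W + 2) * E * I0 ^ (W + 3) :=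
          mul_le_mul_of_nonneg_left hI0pow1 (by
            have : 0 ≤ E := (Real.exp_pos β).le.trans hE
            positivity)
      _ = _ := by ring
  have hNt2 : Nt ≤ I0 ^ (W + 3) * (M ^ (W + 1) * E) := by
    have hE0 : 0 ≤ E := (Real.exp_pos β).le.trans hE
    calc Nt ≤ m ^ (W + 1) * I0 * Real.exp β := hNt1
      _ ≤ (M * I0) ^ (W + 1) * I0 * E :=
          mul_le_mul (mul_le_mul_of_nonneg_right (pow_le_pow_left₀ hm0 hmM _) hI0.le) hE
            (Real.exp_pos β).le (by positivity)
      _ = M ^ (W + 1) * E * (I0 ^ (W + 1) * I0) := by ring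
      _ ≤ M ^ (W + 1) * E * I0 ^ (W + 3) := mul_le_mul_of_nonneg_left hI0pow2 (by positivity)
      _ = _ := by ring
  -- central terms in units of `I₀^V`
  have hZclo : I0 ^ (W + 3) * (1 + 2 * a ^ (W + 3) + 2 * c ^ (W + 3)) ≤
      I0 ^ (W + 3) + 2 * I1 ^ (W + 3) + 2 * besselI 2 β ^ (W + 3) := by
    rw [mul_pow] at hp1lo hp2lo; linarith
  have hZchi : I0 ^ (W + 3) + 2 * I1 ^ (W + 3) + 2 * besselI 2 β ^ (W + 3) ≤
      I0 ^ (W + 3) * (1 + 2 * b ^ (W + 3) + 2 * d ^ (W + 3)) := by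
    rw [mul_pow] at hp1hi hp2hi; linarith
  have hNclo : I0 ^ (W + 3) * (a + a ^ (W + 2) * (1 + c) + c ^ (W + 2) * (a + e)) ≤
      I0 ^ (W + 2) * I1 + I1 ^ (W + 2) * (I0 + besselI 2 β) +
        besselI 2 β ^ (W + 2) * (I1 + besselI 3 β) := by
    have t1 : I0 ^ (W + 2) * (a * I0) ≤ I0 ^ (W + 2) * I1 :=
      mul_le_mul_of_nonneg_left h1lo (by positivity)
    have t2 : (a * I0) ^ (W + 2) * (I0 + c * I0) ≤ I1 ^ (W + 2) * (I0 + besselI 2 β) :=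
      mul_le_mul hq1lo (by linarith) (by positivity) (by positivity)
    have t3 : (c * I0) ^ (W + 2) * (a * I0 + e * I0) ≤
        besselI 2 β ^ (W + 2) * (I1 + besselI 3 β) :=
      mul_le_mul hq2lo (by linarith) (by positivity) (by positivity)
    calc I0 ^ (W + 3) * (a + a ^ (W + 2) * (1 + c) + c ^ (W + 2) * (a + e))
        = I0 ^ (W + 2) * (a * I0) + (a * I0) ^ (W + 2) * (I0 + c * I0) +
            (c * I0) ^ (W + 2) * (a * I0 + e * I0) := by ring
      _ ≤ _ := by linarith
  have hNchi : I0 ^ (W + 2) * I1 + I1 ^ (W + 2) * (I0 + besselI 2 β) +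
        besselI 2 β ^ (W + 2) * (I1 + besselI 3 β) ≤
      I0 ^ (W + 3) * (b + b ^ (W + 2) * (1 + d) + d ^ (W + 2) * (b + f)) := by
    have t1 : I0 ^ (W + 2) * I1 ≤ I0 ^ (W + 2) * (b * I0) :=
      mul_le_mul_of_nonneg_left h1hi (by positivity)
    have t2 : I1 ^ (W + 2) * (I0 + besselI 2 β) ≤ (b * I0) ^ (W + 2) * (I0 + d * I0) :=
      mul_le_mul hq1hi (by linarith) (by positivity) (by positivity)
    have t3 : besselI 2 β ^ (W + 2) * (I1 + besselI 3 β) ≤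
        (d * I0) ^ (W + 2) * (b * I0 + f * I0) :=
      mul_le_mul hq2hi (by linarith) (by positivity) (by positivity)
    calc I0 ^ (W + 2) * I1 + I1 ^ (W + 2) * (I0 + besselI 2 β) +
          besselI 2 β ^ (W + 2) * (I1 + besselI 3 β)
        ≤ I0 ^ (W + 2) * (b * I0) + (b * I0) ^ (W + 2) * (I0 + d * I0) +
            (d * I0) ^ (W + 2) * (b * I0 + f * I0) := by linarith
      _ = _ := by ring
  -- assemble
  have hIV : 0 < I0 ^ (W + 3) := by positivity
  have hZpos : 0 < I0 ^ (W + 3) + 2 * I1 ^ (W + 3) + 2 * besselI 2 β ^ (W + 3) + Zt := by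
    positivity
  have hZlo0 : 0 < 1 + 2 * a ^ (W + 3) + 2 * c ^ (W + 3) := by positivity
  constructor
  · rw [le_div_iff₀ hZpos]
    have k1 := mul_le_mul_of_nonneg_left hlo hIV.le
    have k2 := mul_le_mul_of_nonneg_left hZt2 h0lo
    have k3 := mul_le_mul_of_nonneg_left hZchi h0lo
    have k4 : I0 ^ (W + 3) * (lo * (1 + 2 * b ^ (W + 3) + 2 * d ^ (W + 3) + M ^ (W + 2) * E)) =
        lo * (I0 ^ (W + 3) * (1 + 2 * b ^ (W + 3) + 2 * d ^ (W + 3))) +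
          lo * (I0 ^ (W + 3) * (M ^ (W + 2) * E)) := by ring
    linarith
  · rw [div_le_iff₀ hZpos]
    have hE0 : 0 ≤ E := (Real.exp_pos β).le.trans hE
    have hN0 : 0 ≤ b + b ^ (W + 2) * (1 + d) + d ^ (W + 2) * (b + f) + M ^ (W + 1) * E := by
      positivity
    have hhi0 : 0 ≤ hi :=
      le_of_mul_le_mul_right (by rw [zero_mul]; exact hN0.trans hhi) hZlo0
    have k1 := mul_le_mul_of_nonneg_left hhi hIV.le
    have k2 := mul_le_mul_of_nonneg_left hZclo hhi0
    have k3 := mul_nonneg hhi0 hZt0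
    have k4 : I0 ^ (W + 3) * (hi * (1 + 2 * a ^ (W + 3) + 2 * c ^ (W + 3))) =
        hi * (I0 ^ (W + 3) * (1 + 2 * a ^ (W + 3) + 2 * c ^ (W + 3))) := by ring
    have k5 : I0 ^ (W + 3) * (b + b ^ (W + 2) * (1 + d) + d ^ (W + 2) * (b + f) + M ^ (W + 1) * E) =
        I0 ^ (W + 3) * (b + b ^ (W + 2) * (1 + d) + d ^ (W + 2) * (b + f)) +
          I0 ^ (W + 3) * (M ^ (W + 1) * E) := by ring
    linarith

/-! ### 2. The rational certificate checker and its soundness -/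

/-- The interval-arithmetic part of the certificate (see `torus_ratio_mem_Icc`):
`c = 1 − 2b/β`, `d = 1 − 2a/β`, `e = a − 4d/β`, `f = b − 4c/β`, `g = d − 6e/β`, `M = max f g`; checks
`0 < a`, `0 ≤ c`, `0 ≤ e`, `0 ≤ lo` and the two main inequalities, for `V` plaquettes. -/
def torusRatioCheck (β a b E lo hi : ℚ) (V : ℕ) : Bool :=
  let c := 1 - 2 * b / β
  let d := 1 - 2 * a / β
  let e := a - 4 * d / β
  let f := b - 4 * c / β
  let g := d - 6 * e / β
  let M := max f g
  decide (0 < a) && decide (0 ≤ c) && decide (0 ≤ e) && decide (0 ≤ lo) &&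
    decide (lo * (1 + 2 * b ^ V + 2 * d ^ V + M ^ (V - 1) * E) ≤
      a + a ^ (V - 1) * (1 + c) + c ^ (V - 1) * (a + e)) &&
    decide (b + b ^ (V - 1) * (1 + d) + d ^ (V - 1) * (b + f) + M ^ (V - 2) * E ≤
      hi * (1 + 2 * a ^ V + 2 * c ^ V))

/-- **The torus-plaquette certificate checker**: GEN-5's one-plaquette checker `u1Check β a b K`
(`a ≤ ⟨cos θ⟩_β = I₁/I₀ ≤ b` with `K` Taylor terms) and the interval arithmetic `torusRatioCheck`. -/
def torusPlaqCheck (β a b E lo hi : ℚ) (K V : ℕ) : Bool :=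
  u1Check β a b K && torusRatioCheck β a b E lo hi V

/-- Unpacking `torusRatioCheck … = true`. -/
theorem torusRatioCheck_spec {β a b E lo hi : ℚ} {V : ℕ} (h : torusRatioCheck β a b E lo hi V = true) :
    0 < a ∧ 0 ≤ 1 - 2 * b / β ∧ 0 ≤ a - 4 * (1 - 2 * a / β) / β ∧ 0 ≤ lo ∧
    lo * (1 + 2 * b ^ V + 2 * (1 - 2 * a / β) ^ V +
        (max (b - 4 * (1 - 2 * b / β) / β) ((1 - 2 * a / β) - 6 * (a - 4 * (1 - 2 * a / β) / β) / β))
          ^ (V - 1) * E) ≤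
      a + a ^ (V - 1) * (1 + (1 - 2 * b / β)) + (1 - 2 * b / β) ^ (V - 1) *
        (a + (a - 4 * (1 - 2 * a / β) / β)) ∧
    b + b ^ (V - 1) * (1 + (1 - 2 * a / β)) + (1 - 2 * a / β) ^ (V - 1) *
        (b + (b - 4 * (1 - 2 * b / β) / β)) +
        (max (b - 4 * (1 - 2 * b / β) / β) ((1 - 2 * a / β) - 6 * (a - 4 * (1 - 2 * a / β) / β) / β))
          ^ (V - 2) * E ≤
      hi * (1 + 2 * a ^ V + 2 * (1 - 2 * b / β) ^ V) := by
  simpa [torusRatioCheck, Bool.and_eq_true, decide_eq_true_eq, and_assoc] using h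

/-- **Soundness of the torus certificate**: `torusPlaqCheck β a b E lo hi K V = true`, `0 < β`,
`V = W + 3` and `e^β ≤ E` imply `lo ≤ N/Z ≤ hi` for the exact torus plaquette `N/Z` with `V`
plaquettes. -/
theorem torusPlaqCheck_sound {β a b E lo hi : ℚ} {K : ℕ} (W : ℕ)
    (h : torusPlaqCheck β a b E lo hi K (W + 3) = true) (hβ : (0 : ℝ) < ((β : ℚ) : ℝ))
    (hE : Real.exp ((β : ℚ) : ℝ) ≤ ((E : ℚ) : ℝ)) :
    ((lo : ℚ) : ℝ) ≤ (∑' k : ℤ, besselI k.natAbs ((β : ℚ) : ℝ) ^ (W + 3 - 1) *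
            ((besselI (k - 1).natAbs ((β : ℚ) : ℝ) + besselI (k + 1).natAbs ((β : ℚ) : ℝ)) / 2)) /
          ∑' k : ℤ, besselI k.natAbs ((β : ℚ) : ℝ) ^ (W + 3) ∧
    (∑' k : ℤ, besselI k.natAbs ((β : ℚ) : ℝ) ^ (W + 3 - 1) *
            ((besselI (k - 1).natAbs ((β : ℚ) : ℝ) + besselI (k + 1).natAbs ((β : ℚ) : ℝ)) / 2)) /
          ∑' k : ℤ, besselI k.natAbs ((β : ℚ) : ℝ) ^ (W + 3) ≤ ((hi : ℚ) : ℝ) := by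
  rw [torusPlaqCheck, Bool.and_eq_true] at h
  obtain ⟨hu, hr⟩ := h
  obtain ⟨h0a, h0c, h0e, h0lo, hlo, hhi⟩ := torusRatioCheck_spec hr
  have hab := u1Check_sound hu
  rw [onePlaquetteExpect_cos_eq_besselI_div] at hab
  refine torus_ratio_mem_Icc hβ W hab.1 hab.2 hE
    (c := ((1 - 2 * b / β : ℚ) : ℝ)) (d := ((1 - 2 * a / β : ℚ) : ℝ))
    (e := ((a - 4 * (1 - 2 * a / β) / β : ℚ) : ℝ)) (f := ((b - 4 * (1 - 2 * b / β) / β : ℚ) : ℝ))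
    (g := (((1 - 2 * a / β) - 6 * (a - 4 * (1 - 2 * a / β) / β) / β : ℚ) : ℝ))
    (M := ((max (b - 4 * (1 - 2 * b / β) / β)
      ((1 - 2 * a / β) - 6 * (a - 4 * (1 - 2 * a / β) / β) / β) : ℚ) : ℝ))
    (by push_cast; ring) (by push_cast; ring) (by push_cast; ring) (by push_cast; ring)
    (by push_cast; ring) (by push_cast; rfl) (by exact_mod_cast h0a) (by exact_mod_cast h0c)
    (by exact_mod_cast h0e) (by exact_mod_cast h0lo) ?_ ?_
  · have := hlo
    simp only [show W + 3 - 1 = W + 2 from rfl] at this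
    exact_mod_cast this
  · have := hhi
    simp only [show W + 3 - 1 = W + 2 from rfl, show W + 3 - 2 = W + 1 from rfl] at this
    exact_mod_cast this

end Summit.Ventures.LatticeQCDFlow.Scoring
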